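import Summits.CriticalPhenomena.SAWScalingLimit.Theorems.SAWDefectDecoherenceMassRatioOccupationIdentity
import Summits.CriticalPhenomena.SAWScalingLimit.Theorems.SAWDefectDecoherenceMassRatioTipContinuation

/-!
# The cage dichotomy for boundary-rooted bulk mass (crux `MassRatio`, stmt-CriticalPhenomena-8550;
STRATEGY-CENSUS §6, the arithmetic of `PolyBulk(k) ⟸ (E1) ∧ (E2) ∧ CageTail(k)`)

Finite-volume, frame-independent inequalities for the critical (or any `x ≥ 0`) spin-`0` masses
`Z_Λ(a → e) = ‖F^{Λ}_{x,0}(a → e)‖` of a hexagonal domain `Λ` with root mid-edge `a`, over a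
finite set `S` of non-boundary mid-edges ("the mid-edges in the compact `K`"). For a walk
`γ ⊂ Ω : a → e` write (informally; everything below is spelled out)
`Esc(γ) := Σ_{boundary darts (v',t') of Λ} Z_{Λ∖γ}(e → {t',v'})` for the continuation mass from
the tip of `γ`, in its slit domain, to the ORIGINAL boundary `∂Ω`, and
`Θ_a := Σ_{boundary darts (v',t') of Λ} Z_Λ(a → {t',v'})` for the total boundary arrival mass
from the root.

* `occupation_boundary_sum_le` — (E1) summed over the boundary darts:
  `Σ_{e∈S} Σ_{γ:a→e} x^{ℓ(γ)} Esc(γ) ≤ |S| · Θ_a` (from `occupation_le_card_mul_norm`).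
* `cage_dichotomy` — Markov's inequality on top: for every threshold `θ > 0`,
  `Σ_{e∈S} Z_Λ(a → e) ≤ θ⁻¹ |S| Θ_a + Σ_{e∈S} Σ_{γ:a→e, Esc(γ)<θ} x^{ℓ(γ)}` — the bulk mass is
  carried either by walks whose tip still sees the boundary with mass `≥ θ` (at most
  `θ⁻¹|S|Θ_a` of them, in `x`-mass) or by CAGED walks (`Esc < θ`).
* `bulk_le_of_cageTail` — hence the census's `CageTail` hypothesis "caged walks carry at most
  half of the mass" gives `Σ_{e∈S} Z_Λ(a → e) ≤ 2 θ⁻¹ |S| Θ_a` (with `θ = δ^k`, `|S| ≤ C_K δ⁻²` and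
  a tame-frame bound on `Θ_a` this is `PolyBulk(k)`: `δ² Σ_K Z ≤ C δ^{-k}`).
* `self_arrival_ge_of_escape` — the (E2) side of a cage at `x = x_c`: by the tip sum rule
  (`tip_continuation_ge_one`) the continuation mass from a free tip totals at least `1`, so a walk
  with `Esc(γ) ≤ θ` puts continuation mass `≥ 1 − θ` on arrivals at the faces of `γ` ITSELF
  (tame self-closures) — the handle by which `CageTail` is to be attacked.

Deliberately NOT here: `CageTail` itself (open; census §6 (E3)), any asymptotics or frame.
-/

noncomputable section

namespace Summit.CriticalPhenomena.SAWScalingLimit.Theorems.MassRatio.Occupation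

open Literature.Probability.LatticeModels Literature.Probability.RandomPlanarGeometry
open Literature.Probability.RandomPlanarGeometry.SAW
open Literature.Barriers.CriticalPhenomena Literature.Barriers.CriticalPhenomena.HexGreen
open Summit.CriticalPhenomena.SAWScalingLimit.Theorems.MassRatio.Negative

variable {Λ : Finset HexVertex} {a : Sym2 HexVertex}

/-! ### (E1) summed over the boundary darts -/

/-- A boundary dart `(v', t')` (`v' ∈ Λ`, `t' ∼ v'`, `t' ∉ Λ`) spans a boundary mid-edge
`{t', v'} ∈ ∂Ω`. [cite: DuminilCopinSmirnov2012, §2 (domains)] -/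
theorem mk_mem_hexDomainBoundary_of_dart {v' t' : HexVertex} (hv' : v' ∈ Λ)
    (ht' : t' ∈ (nbrs v').filter (· ∉ Λ)) : s(t', v') ∈ hexDomainBoundary Λ := by
  obtain ⟨hn, htΛ⟩ := Finset.mem_filter.1 ht'
  have hadj : hexGraph.Adj v' t' := (mem_nbrs_iff v' t').1 hn
  exact ⟨(SimpleGraph.mem_edgeSet _).2 hadj.symm, t', v', rfl, hv', htΛ⟩

/-- A boundary mid-edge is not in a set of non-boundary mid-edges. [folklore] -/
theorem not_mem_of_mem_hexDomainBoundary {S : Finset (Sym2 HexVertex)}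
    (hS : ∀ e ∈ S, e ∉ hexDomainBoundary Λ) {b : Sym2 HexVertex} (hb : b ∈ hexDomainBoundary Λ) :
    b ∉ S := fun h => hS b h hb

/-- Moving a double finset sum past a finset sum and a dependent `Fintype` sum:
`Σ_{i∈S} Σ_{k : κ i} Σ_{a∈A} Σ_{b∈B a} f = Σ_{a∈A} Σ_{b∈B a} Σ_{i∈S} Σ_{k : κ i} f`. [folklore] -/
theorem sum_sum_sum_sum_comm {ι α β : Type*} {κ : ι → Type*} [∀ i, Fintype (κ i)]
    (S : Finset ι) (A : Finset α) (B : α → Finset β) (f : ∀ i, κ i → α → β → ℝ) :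
    ∑ i ∈ S, ∑ k : κ i, ∑ a ∈ A, ∑ b ∈ B a, f i k a b =
      ∑ a ∈ A, ∑ b ∈ B a, ∑ i ∈ S, ∑ k : κ i, f i k a b := by
  calc ∑ i ∈ S, ∑ k : κ i, ∑ a ∈ A, ∑ b ∈ B a, f i k a b
      = ∑ i ∈ S, ∑ a ∈ A, ∑ k : κ i, ∑ b ∈ B a, f i k a b :=
        Finset.sum_congr rfl fun i _ => Finset.sum_comm
    _ = ∑ a ∈ A, ∑ i ∈ S, ∑ k : κ i, ∑ b ∈ B a, f i k a b := Finset.sum_comm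
    _ = ∑ a ∈ A, ∑ i ∈ S, ∑ b ∈ B a, ∑ k : κ i, f i k a b :=
        Finset.sum_congr rfl fun a _ => Finset.sum_congr rfl fun i _ => Finset.sum_comm
    _ = ∑ a ∈ A, ∑ b ∈ B a, ∑ i ∈ S, ∑ k : κ i, f i k a b :=
        Finset.sum_congr rfl fun a _ => Finset.sum_comm

/-- **(E1) summed over the boundary: occupation-weighted escape mass is at most `|S|` times the
total boundary arrival mass.** For a root mid-edge `a ∉ S`, a finite set `S` of non-boundary
mid-edges and `x ≥ 0`:
`Σ_{e∈S} Σ_{γ:a→e} x^{ℓ(γ)} · Σ_{darts (v',t')} Z_{Λ∖γ}(e → {t',v'}) ≤ |S| · Σ_{darts (v',t')} Z_Λ(a → {t',v'})`.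
(Swap the sums and apply `occupation_le_card_mul_norm` at each boundary mid-edge.)
[cite: DuminilCopinSmirnov2012, §2 (domain Markov property)] -/
theorem occupation_boundary_sum_le (S : Finset (Sym2 HexVertex)) (haS : a ∉ S)
    (hS : ∀ e ∈ S, e ∉ hexDomainBoundary Λ) {x : ℝ} (hx : 0 ≤ x) :
    ∑ e ∈ S, ∑ γ : HexMidEdgeSAW Λ a e, x ^ γ.length *
        ∑ v' ∈ Λ, ∑ t' ∈ (nbrs v').filter (· ∉ Λ),
          ‖hexParafermionicObservable (Λ \ γ.verts.toFinset) e x 0 s(t', v')‖ ≤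
      S.card * ∑ v' ∈ Λ, ∑ t' ∈ (nbrs v').filter (· ∉ Λ),
        ‖hexParafermionicObservable Λ a x 0 s(t', v')‖ := by
  -- move the dart sums outside
  have hswap : ∑ e ∈ S, ∑ γ : HexMidEdgeSAW Λ a e, x ^ γ.length *
        ∑ v' ∈ Λ, ∑ t' ∈ (nbrs v').filter (· ∉ Λ),
          ‖hexParafermionicObservable (Λ \ γ.verts.toFinset) e x 0 s(t', v')‖ =
      ∑ v' ∈ Λ, ∑ t' ∈ (nbrs v').filter (· ∉ Λ), ∑ e ∈ S, ∑ γ : HexMidEdgeSAW Λ a e,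
        x ^ γ.length * ‖hexParafermionicObservable (Λ \ γ.verts.toFinset) e x 0 s(t', v')‖ := by
    simp_rw [Finset.mul_sum]
    exact sum_sum_sum_sum_comm S Λ (fun v' => (nbrs v').filter (· ∉ Λ))
      (fun e (γ : HexMidEdgeSAW Λ a e) v' t' =>
        x ^ γ.length * ‖hexParafermionicObservable (Λ \ γ.verts.toFinset) e x 0 s(t', v')‖)
  rw [hswap, Finset.mul_sum]
  refine Finset.sum_le_sum fun v' hv' => ?_
  rw [Finset.mul_sum]
  refine Finset.sum_le_sum fun t' ht' => ?_
  have hb : s(t', v') ∈ hexDomainBoundary Λ := mk_mem_hexDomainBoundary_of_dart hv' ht'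
  exact occupation_le_card_mul_norm Λ a _ hb S haS (not_mem_of_mem_hexDomainBoundary hS hb) x hx

/-! ### The cage dichotomy (Markov's inequality) -/

/-- Pointwise Markov step: `w ≤ θ⁻¹ (w · E) + [E < θ] w` for `w ≥ 0`, `E ≥ 0`, `θ > 0`. [folklore] -/
theorem le_inv_mul_add_ite {w E θ : ℝ} (hw : 0 ≤ w) (hE : 0 ≤ E) (hθ : 0 < θ) :
    w ≤ θ⁻¹ * (w * E) + (if E < θ then w else 0) := by
  split_ifs with h
  · have : 0 ≤ θ⁻¹ * (w * E) := mul_nonneg (inv_nonneg.2 hθ.le) (mul_nonneg hw hE)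
    linarith
  · have h1 : w * θ ≤ w * E := mul_le_mul_of_nonneg_left (not_lt.1 h) hw
    have h2 : θ⁻¹ * (w * θ) = w := by field_simp
    calc w = θ⁻¹ * (w * θ) := h2.symm
      _ ≤ θ⁻¹ * (w * E) := mul_le_mul_of_nonneg_left h1 (inv_nonneg.2 hθ.le)
      _ = θ⁻¹ * (w * E) + 0 := (add_zero _).symm

/-- **The cage dichotomy.** For a root mid-edge `a ∉ S`, a finite set `S` of non-boundary mid-edges,
`x ≥ 0` and a threshold `θ > 0`:
`Σ_{e∈S} Z_Λ(a → e) ≤ θ⁻¹ · |S| · Θ_a + Σ_{e∈S} Σ_{γ:a→e, Esc(γ) < θ} x^{ℓ(γ)}`,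
where `Θ_a = Σ_{darts} Z_Λ(a → ·)` is the total boundary arrival mass from the root and
`Esc(γ) = Σ_{darts} Z_{Λ∖γ}(e → ·)` the continuation mass from the tip of `γ` to the original
boundary: walks whose tip escapes with mass `≥ θ` carry at most `θ⁻¹|S|Θ_a` (Markov on
`occupation_boundary_sum_le`), the rest are caged. (STRATEGY-CENSUS §6: with `θ = δ^k` this is
`PolyBulk(k) ⟸ (E1) ∧ CageTail(k)` at finite volume.)
[cite: DuminilCopinSmirnov2012, §2 (domain Markov property)] -/
theorem cage_dichotomy : ∀ (Λ : Finset HexVertex) (a : Sym2 HexVertex) (S : Finset (Sym2 HexVertex)), a ∉ S → (∀ e ∈ S, e ∉ hexDomainBoundary Λ) → ∀ (x θ : ℝ), 0 ≤ x → 0 < θ → ∑ e ∈ S, ‖hexParafermionicObservable Λ a x 0 e‖ ≤ θ⁻¹ * (S.card * ∑ v' ∈ Λ, ∑ t' ∈ (nbrs v').filter (· ∉ Λ), ‖hexParafermionicObservable Λ a x 0 s(t', v')‖) + ∑ e ∈ S, ∑ γ ∈ (Finset.univ : Finset (HexMidEdgeSAW Λ a e)).filter (fun γ => ∑ v' ∈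 Λ, ∑ t' ∈ (nbrs v').filter (· ∉ Λ), ‖hexParafermionicObservable (Λ \ γ.verts.toFinset) e x 0 s(t', v')‖ < θ), x ^ γ.length := by
  intro Λ a S haS hS x θ hx hθ
  have hE1 := occupation_boundary_sum_le S haS hS hx
  -- pointwise Markov, summed
  have hpt : ∑ e ∈ S, ‖hexParafermionicObservable Λ a x 0 e‖ ≤
      ∑ e ∈ S, ∑ γ : HexMidEdgeSAW Λ a e,
        (θ⁻¹ * (x ^ γ.length * ∑ v' ∈ Λ, ∑ t' ∈ (nbrs v').filter (· ∉ Λ),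
            ‖hexParafermionicObservable (Λ \ γ.verts.toFinset) e x 0 s(t', v')‖) +
          (if ∑ v' ∈ Λ, ∑ t' ∈ (nbrs v').filter (· ∉ Λ),
              ‖hexParafermionicObservable (Λ \ γ.verts.toFinset) e x 0 s(t', v')‖ < θ
            then x ^ γ.length else 0)) := by
    refine Finset.sum_le_sum fun e _ => ?_
    rw [norm_Z_eq_sum _ _ _ hx]
    refine Finset.sum_le_sum fun γ _ => le_inv_mul_add_ite (pow_nonneg hx _) ?_ hθ
    exact Finset.sum_nonneg fun _ _ => Finset.sum_nonneg fun _ _ => norm_nonneg _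
  refine hpt.trans ?_
  -- the caged part, as a filtered sum
  have hcaged : ∀ e : Sym2 HexVertex,
      ∑ γ ∈ (Finset.univ : Finset (HexMidEdgeSAW Λ a e)).filter (fun γ =>
          ∑ v' ∈ Λ, ∑ t' ∈ (nbrs v').filter (· ∉ Λ),
            ‖hexParafermionicObservable (Λ \ γ.verts.toFinset) e x 0 s(t', v')‖ < θ),
          x ^ γ.length =
        ∑ γ : HexMidEdgeSAW Λ a e,
          (if ∑ v' ∈ Λ, ∑ t' ∈ (nbrs v').filter (· ∉ Λ),
              ‖hexParafermionicObservable (Λ \ γ.verts.toFinset) e x 0 s(t', v')‖ < θ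
            then x ^ γ.length else 0) :=
    fun e => Finset.sum_filter _ _
  rw [Finset.sum_congr rfl fun e _ => hcaged e]
  simp_rw [Finset.sum_add_distrib, ← Finset.mul_sum]
  exact add_le_add (mul_le_mul_of_nonneg_left hE1 (inv_nonneg.2 hθ.le)) le_rfl

/-- **Bulk mass under a cage-tail bound.** If the caged walks (`Esc(γ) < θ`) carry at most half of
the mass `Σ_{e∈S} Z_Λ(a → e)`, then `Σ_{e∈S} Z_Λ(a → e) ≤ 2 θ⁻¹ |S| Θ_a`. (STRATEGY-CENSUS §6:
`PolyBulk(k) ⟸ (E1) ∧ CageTail(k)`, finite-volume form; `θ = δ^k`, `|S| ≤ C_K δ⁻²`, `Θ_a ≤ C` in a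
tame frame.) [folklore] -/
theorem bulk_le_of_cageTail : ∀ (Λ : Finset HexVertex) (a : Sym2 HexVertex) (S : Finset (Sym2 HexVertex)), a ∉ S → (∀ e ∈ S, e ∉ hexDomainBoundary Λ) → ∀ (x θ : ℝ), 0 ≤ x → 0 < θ → (∑ e ∈ S, ∑ γ ∈ (Finset.univ : Finset (HexMidEdgeSAW Λ a e)).filter (fun γ => ∑ v' ∈ Λ, ∑ t' ∈ (nbrs v').filter (· ∉ Λ), ‖hexParafermionicObservable (Λ \ γ.verts.toFinset) e x 0 s(t', v')‖ < θ), x ^ γ.length) ≤ (1 / 2) * ∑ e ∈ S, ‖hexParafermionicObservable Λ a x 0 e‖ → ∑ e ∈ S, ‖hexParafermionicObservable Λ a x 0 e‖ ≤ 2 * θ⁻¹ * (S.card * ∑ v' ∈ Λ, ∑ t' ∈ (nbrs v').filter (· ∉ Λ), ‖hexParafermionicObservable Λ a x 0 s(t', v')‖) := by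
  intro Λ a S haS hS x θ hx hθ hcage
  have h := cage_dichotomy Λ a S haS hS x θ hx hθ
  linarith

/-! ### The (E2) side of a cage: caged tips self-close -/

/-- **Escape plus self-arrival is at least `1` (the tip sum rule, split).** Let `Λ` be simply
connected with boundary root `a = {u, w}` (`u ∉ Λ`), `γ ⊂ Ω : a → {v, t}` a nonempty walk with tip
vertex `v = last γ` whose tip mid-edge is a mid-edge of the slit domain `Λ' = Λ ∖ γ`. Then at
`x = x_c` the continuation masses from the tip in `Λ'` to the ORIGINAL boundary darts (`t' ∉ Λ`),
plus those to the darts pointing into `γ` itself (`t' ∈ γ`, the tip dart excluded), total at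
least `1`. [cite: DuminilCopinSmirnov2012, §3 (sum of the vertex relation over a domain)] -/
theorem one_le_escape_add_self (hΛ : hexDomainSimplyConnected Λ) {u w : HexVertex} (hu : u ∉ Λ)
    {v t : HexVertex} (γ : HexMidEdgeSAW Λ s(u, w) s(v, t)) (hne : γ.verts ≠ [])
    (hv : γ.verts.getLast hne = v) (heM : s(v, t) ∈ hexDomainMidEdges (Λ \ γ.verts.toFinset)) :
    1 ≤ (∑ v' ∈ Λ \ γ.verts.toFinset, ∑ t' ∈ (nbrs v').filter (· ∉ Λ),
        ‖hexParafermionicObservable (Λ \ γ.verts.toFinset) s(v, t) hexCriticalFugacity 0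
          s(t', v')‖) +
      ∑ v' ∈ Λ \ γ.verts.toFinset, ∑ t' ∈ (nbrs v').filter (· ∈ γ.verts),
        (if v' = t ∧ t' = v then 0 else
          ‖hexParafermionicObservable (Λ \ γ.verts.toFinset) s(v, t) hexCriticalFugacity 0
            s(t', v')‖) := by
  classical
  have h1 := tip_continuation_ge_one Λ hΛ u w hu v t γ hne hv heM
  have hvγ : v ∈ γ.verts := by
    have h := List.getLast_mem hne
    rwa [hv] at h
  have hvΛ : v ∈ Λ := γ.subset v hvγ
  rw [← Finset.sum_add_distrib]
  refine h1.trans (le_of_eq (Finset.sum_congr rfl fun v' _ => ?_))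
  -- split the darts of the slit domain at `v'`: `t' ∉ Λ ∖ γ ↔ t' ∉ Λ ∨ t' ∈ γ`, disjointly
  have hfilter : (nbrs v').filter (· ∉ Λ \ γ.verts.toFinset) =
      (nbrs v').filter (· ∉ Λ) ∪ (nbrs v').filter (· ∈ γ.verts) := by
    ext t'
    simp only [Finset.mem_filter, Finset.mem_union, Finset.mem_sdiff, List.mem_toFinset, not_and,
      not_not]
    constructor
    · rintro ⟨hn, h⟩
      by_cases ht : t' ∈ Λ
      · exact Or.inr ⟨hn, h ht⟩
      · exact Or.inl ⟨hn, ht⟩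
    · rintro (⟨hn, h⟩ | ⟨hn, h⟩)
      · exact ⟨hn, fun ht => absurd ht h⟩
      · exact ⟨hn, fun _ => h⟩
  have hdisj : Disjoint ((nbrs v').filter (· ∉ Λ)) ((nbrs v').filter (· ∈ γ.verts)) := by
    rw [Finset.disjoint_filter]
    intro t' _ ht hγ
    exact ht (γ.subset t' hγ)
  rw [hfilter, Finset.sum_union hdisj]
  congr 1
  refine Finset.sum_congr rfl fun t' ht' => ?_
  have htΛ : t' ∉ Λ := (Finset.mem_filter.1 ht').2
  have hne' : ¬(v' = t ∧ t' = v) := fun h => htΛ (h.2 ▸ hvΛ)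
  rw [if_neg hne']

/-- **Caged tips self-close (the (E2) side of the census's cage analysis).** In the setting of
`one_le_escape_add_self`: if the continuation mass from the tip of `γ` to the original boundary
`∂Ω` (summed over ALL boundary darts of `Λ`; the darts at vertices of `γ` contribute `0`) is at
most `θ`, then the continuation mass onto the faces of `γ` itself is at least `1 − θ`.
[cite: DuminilCopinSmirnov2012, §3 (sum of the vertex relation over a domain)] -/
theorem self_arrival_ge_of_escape : ∀ (Λ : Finset HexVertex), hexDomainSimplyConnected Λ → ∀ (u w : HexVertex), u ∉ Λ → ∀ (v t : HexVertex) (γ : HexMidEdgeSAW Λ s(u, w) s(v, t)) (hne : γ.verts ≠ []), γ.verts.getLast hne = v → s(v, t) ∈ hexDomainMidEdges (Λ \ γ.verts.toFinset) → ∀ (θ : ℝ), (∑ v' ∈ Λ, ∑ t' ∈ (nbrs v').filter (· ∉ Λ), ‖hexParafermionicObservable (Λ \ γ.verts.toFinset) s(v, t) hexCriticalFugacity 0 s(t', v')‖) ≤ θ → 1 - θ ≤ ∑ v' ∈ Λ \ γ.verts.toFinset, ∑ t' ∈ (nbrs v').filter (· ∈ γ.verts), (if v' = t ∧ t' = v then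 0 else ‖hexParafermionicObservable (Λ \ γ.verts.toFinset) s(v, t) hexCriticalFugacity 0 s(t', v')‖) := by
  intro Λ hΛ u w hu v t γ hne hv heM θ hesc
  have h1 := one_le_escape_add_self hΛ hu γ hne hv heM
  -- the escape sum over the slit domain is at most the one over `Λ`
  have hmono : ∑ v' ∈ Λ \ γ.verts.toFinset, ∑ t' ∈ (nbrs v').filter (· ∉ Λ),
        ‖hexParafermionicObservable (Λ \ γ.verts.toFinset) s(v, t) hexCriticalFugacity 0
          s(t', v')‖ ≤
      ∑ v' ∈ Λ, ∑ t' ∈ (nbrs v').filter (· ∉ Λ),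
        ‖hexParafermionicObservable (Λ \ γ.verts.toFinset) s(v, t) hexCriticalFugacity 0
          s(t', v')‖ :=
    Finset.sum_le_sum_of_subset_of_nonneg Finset.sdiff_subset fun _ _ _ =>
      Finset.sum_nonneg fun _ _ => norm_nonneg _
  linarith

end Summit.CriticalPhenomena.SAWScalingLimit.Theorems.MassRatio.Occupation
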